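import Summits.QuantumFields.YangMills.Theorems.BalabanUVNodesN12MinimiserFamilyAtRecordBjTower
import Summits.QuantumFields.YangMills.Theorems.BalabanUVNodesN12MinimiserFamilyAtRecordBjTowerNearFlat
import Literature.MathematicalPhysics.QuantumFieldTheory.Balaban1983to89.B15ShellGauge193Local
import Literature.MathematicalPhysics.QuantumFieldTheory.Balaban1983to89.B15Prop1Carrier
import HarnessLib

/-!
# BalabanUVNodes ∕ N12 — THE (J0′) JUNCTION BY NAME, TOWER EDITION: the knit's displayed `hMin` ROW SHAPE (12Q ∕ 12X-W «DIRECT v11», p703802 ∕ p704012) FROM (E) + (β) + (T1@q₀) PER BASE FIELD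
# ([Balaban1989LargeFieldI] (1.74) p.192, p.193 ll.14–20, Prop. 1 p.194; [Balaban1985Variational] Thm 1 p.279, Sect. C (44)–(48) p.285, (82)–(83) p.290, Prop. 9 (190) p.309; [Balaban1989LargeFieldII]
# (1.9) p.358; [Balaban1988Convergent] (2.2) p.255, (2.10)–(2.13) pp.256–257; [Balaban1985Averaging] Prop. 2 p.26; [Balaban1987RG1] (0.4) p.253)

Cell `pub-ymgap` (HUMAN RULINGS D-0062 ∕ D-0149), seat `pub-ymgap-dag-n12-d` g23 (R134 N12 [B15] s2 = by-name knit at the record; census item E1 = the (J0′) row; count-neutral helper of K1⁹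
`stmt-QuantumFields-27364`, `--kind proof --supports … --as helper`).  THEOREMS ONLY (0 `def`, 0 `instance`, 0 `sorry`); compositions BY NAME (v1.0 p711030: §1; v1.1: §2 over the near-flat sibling).  Sibling of `N12MinimiserFamilyKnitRow`
(p707982: §1–§3 over the (0.4)-guarded producers of dag-n12-w1 g4 ∕ dag-n12-w6 g11) — kept in its own leaf for the 400-line rule; same statement shape, same consumer recipe.

WHAT.  §1–§3 of the sibling junction the knit pair's displayed (J0′) row (binders `R 𝓐₀` + the ∀-body `hMin`) to producers that still display, per base field, the two GLOBAL (0.4) guards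
`hsbQ`∕`hsbU` (a small-field-regime reading, dag-n12-c's LOCATED-E1-HSB).  THIS FILE junctions it to this seat's knit link #2 `N12MinimiserFamilyAtRecordBjTower.
hMin_closedGuard_atRecord_Bj_of_printLetters_ofClassTower` — the w1 lineage's chart theorem at `𝐁_k(Z)` over the LANE's TOWER producer (`B15Prop1MinimiserFamilyFromThm1AtBaseCentralTower` ∕
`N12MinimiserFamilyOfClassTowerGuards`, dag-n12-c g24 (r1)(r2)(r3)), whose per-base-field letters are (E) the minimiser, the datum's scale-`k` regularity on `Z`, (β) and (T1@q₀) — and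
DISCHARGES the datum-regularity row from the knit's OWN geometry rows: a base field of the closed guard `|V_k(∂p′) − 1| ≤ eR` on `(Z ∩ Λᶜ)^{(k)}` has a p. 193 extension `Ṽ_k = ext V_k`
that is `12d(n+2)²·2eR`-regular on `Z^{(k)}` (`B15ShellGauge193Local.dist1_plaqHol_extend_shellGauge_le`, [IV] p. 193 ll. 14–16), hence `2(cE+1)eR`-regular for the knit's extension
constant `cE ≥ 12d(n+2)²` (12Q v11's `hcE`).  RESULT: the knit's `hMin P i` row is, under `∃ R > 0`, a theorem of (E) + (β) + (T1@q₀) per base field (NODE 00 ∕ N07 currencies,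
print's own), the per-height existence letters `ρ″`∕`hHB` with volume-free floors, and numerics — E1 (knit side) reduced BY NAME to print-shaped rows with NO hidden small-field regime.

WHY NOT INSIDE THE KNIT (LOCATED-E1-KNIT, sibling's module docstring): displaying these rows INSTEAD of `R 𝓐₀ hMin` in 12Q∕12X-W would bind the implicit-function radius existentially before the
threshold∕floor rows — vacuous by shape (`R ↓ 0 ⇒ Θ(R) ↓ 0`); the junction therefore lives consumer-side: `obtain ⟨R, hR, hMin⟩ := exists_R_hMinRow_of_printLetters_ofClassTower …` feeds the
knit at `R P i := R`.

HONEST FRAMING ∕ LOCATED.  One composition by name + 8 lines of arithmetic; (E)∕(β)∕(T1@q₀) DISPLAYED ([15] Thm 1 existence, (1.9)∕[15] (47) positivity, [15] Thm 1 uniqueness — NOT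
discharged here); per-height letters = EXISTENCE constants (census U4; print's volume-uniform (46)∕(83) NOT claimed); new displayed coupling `6(d−1)Lᵏ·2(cE+1)eR ≤ ρ″` (guard radius
against the height's near-flat radius); nothing of Bałaban's estimates asserted; N12 NOT discharged; K1⁹ NOT closed; counts unmoved; one finite 𝕋⁴ programme at fixed `ε = L^{-K}` — R4
closes only the conditional rung `BalabanLadder.UV`; no summit statement is proved here and NOT the Yang–Mills mass gap (Clay); nothing continuum ∕ ℝ⁴ ∕ OS.
-/

noncomputable section

namespace Summit.QuantumFields.YangMills.BalabanUVNodes.N12MinimiserFamilyKnitRowTower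

open scoped BigOperators Matrix.Norms.L2Operator Topology
open Literature.MathematicalPhysics.QuantumFieldTheory.Balaban1983to89
open T4Continuum
open B15DeterminingSets GaugeField
open ExpMeanLog (expMeanLogSU deltaSU)
open T4AdjointCovarianceUnitary (lieSU)
open Node00
open B15SU2ChartHolomorphic (genE)
open B15Prop1AnalyticExtClause (cplxVec)
open B15Prop1ChartCalculusSU2 (E3)
open T4CubeChartGnomonic (SU2)
open B14.Eq213DetSet (Bj maxDomT Bj_of_gt)
open B14.Eq213MaximalDomains (side)
open B14.Eq22Determines (IsBlockUnion)
open B14.Eq216Concrete (feeds)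
open B5Eq118OneStroke (iterBlockOf)
open B15Eq112TorusCover (lift)
open T4AxialGaugeSmallField (boxPlaqs castSite)
open Summit.QuantumFields.YangMills.BalabanUVNodes.N12MinimiserFamilyAtRecordBjTower (hMin_closedGuard_atRecord_Bj_of_printLetters_ofClassTower)
open Summit.QuantumFields.YangMills.BalabanUVNodes.N12MinimiserFamilyAtRecordBjTowerNearFlat (hMin_closedGuard_atRecord_Bj_of_printLetters_ofClassTowerNearFlat)
open Literature.MathematicalPhysics.QuantumFieldTheory.BalabanImbrieJaffe1984to88.BIJ85Eq453GaugeField (qsstarGIter0)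
open B15AveragingHolomorphic (iterMh)
open B15SU2ChartHolomorphic (expMulC logCoordC)
open B15ShellGauge193 (shellGauge)
open B15Extension193 (extend)
open B16Sect1Backgrounds (toMS expMul)
open B15Prop1ChartSU2 (su2Chart)
open Metric (ball)
open B15Prop1Carrier (plaqsInside)
open B15Prop1ClosedGuardUniformRadius (plaqLeOn_of_plaqSmallOn)
open B15ShellGauge193Local (dist1_plaqHol_extend_shellGauge_le)

variable {F : T4Family} {k : ℕ}


/-! ## §1  The knit's `hMin` row shape from KNIT LINK #2 `N12MinimiserFamilyAtRecordBjTower` (this seat, over the lane's TOWER producer) — NO (0.4) guard, NO plaquette guard, NO surjectivity row, NO (45) row,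
and the datum's regularity row DISCHARGED from the knit's own geometry: per base field EXACTLY (E) + (β) + (T1@q₀) -/

/-- ★★★ **THE KNIT's (J0′) ROW SHAPE, UNDER `∃ R > 0`, FROM (E) + (β) + (T1@q₀) PER BASE FIELD** — over `N12MinimiserFamilyAtRecordBjTower.hMin_closedGuard_atRecord_Bj_of_printLetters_ofClassTower`
(the w1 lineage's chart theorem at `𝐁_k(Z)` re-keyed to the lane's tower producer `B15Prop1MinimiserFamilyFromThm1AtBaseCentralTower` ∕ `N12MinimiserFamilyOfClassTowerGuards`, with dag-n12-w6's
velocity (45) and the class ∕ forest ∕ definitional letters discharged).  The ONE per-base-field row of that theorem which is not print's — the datum's scale-`k` regularity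
`PlaqSmallOn (plaqsInside (pts k Z)) δ (ext V_k)` — is DISCHARGED here at `δ := 2(cE+1)·eR` from the closed guard `|V_k(∂p′) − 1| ≤ eR` on `(Z ∩ Λᶜ)^{(k)}` and the p. 193 extension
(`B15ShellGauge193Local.dist1_plaqHol_extend_shellGauge_le`: `Ṽ_k = ext V_k` is `12d(n+2)²·ε`-regular on `Z^{(k)}` for `ε`-regular `V_k`; [IV] p. 193 ll. 14–16) through the knit's
own geometry rows `hn hN3 hlohi hbox hZ` and extension constant `cE ≥ 12d(n+2)²` (12Q v11's binders).  What the consumer supplies per base field of the closed guard: (E) the (2.12)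
minimiser `U₀`, (β) on every forest axial slice (kernel in `DΦ₀(0)` currency), (T1@q₀) over the closure of the class — NODE 00 ∕ N07 currencies, print's own; once per height: `ρ″` with
the floors `6(d−1)L·εreg ≤ ρ″`, `6(d−1)Lᵏ·2(cE+1)eR ≤ ρ″` (guard radius against near-flat radius), `hHB` + `εreg ≤ εH`; numerics incl. `3 ≤ d`, (Gᵃ) `IsBlockUnion k Z`, `(d+14)L ≤ M₁`.
Conclusion: 12Q ∕ 12X-W v11's `hMin P i` ∀-body on the strict guard.  E1 (knit side) is thereby reduced BY NAME to (E)+(β)+(T1@q₀).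
[cite: Balaban1989LargeFieldI, (1.74) p.192, p.193 L14–20, Prop. 1 p.194; Balaban1985Variational, Thm 1 p.279, (7) p.278, Sect. C (44)–(48) p.285, (82)–(83) p.290, Prop. 9 (190) p.309; Balaban1989LargeFieldII, (1.9) p.358; Balaban1988Convergent, (2.2) p.255, (2.10)–(2.13) pp.256–257; Balaban1985Averaging, Prop. 2 (52)–(54) p.26; Balaban1987RG1, (0.4) p.253] -/
theorem exists_R_hMinRow_of_printLetters_ofClassTower (ν : Node00.Stage7Numerics) (Kt : ℕ) (hd3 : 3 ≤ (F.P Kt).d) (Z Λ : Set (Site (F.P Kt) 0))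
    (lo hi : Fin (F.P Kt).d → ℤ) (hkK : k + 1 ≤ (F.P Kt).m + (F.P Kt).K) (hk1 : 1 ≤ k)
    (hdiv : side (F.P Kt).L ν.M₁ k ∣ (F.P Kt).sitesPerDir 0) (hfloor : ((F.P Kt).d + 14) * (F.P Kt).L ≤ ν.M₁) (hZblk : IsBlockUnion k Z) (hε : 0 < ν.εreg)
    (hα3 : (143 * (((((F.P Kt).d + 4 : ℕ) : ℝ)) ^ 2 / 4) ^ 2) * (2 * ((F.P Kt).L : ℝ) ^ 2 * ν.εreg) ≤ 1 / 3)
    (hα2 : 2 * (2 * ((F.P Kt).L : ℝ) ^ 2 * ν.εreg) ≤ 2 * deltaSU (Fin 2) / ((((F.P Kt).d + 4) * (F.P Kt).L : ℕ) : ℝ) ^ 2)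
    -- the per-HEIGHT letters: the near-flat small-below radius `ρ″` (`Node00.exists_uniform_chartCurvature_sq_bound`) with its two volume-free floors (the lane's tower-box budget at the
    -- datum's regularity `δ`), and dag-n12-w6's (P4)′ proxies letter `hHB` at `(εH, B)` (p678596's ∀-body) with `εreg ≤ εH`
    {ρ'' : ℝ} (hsbU : ∀ W : GaugeField (F.P Kt) 0 SU2, ‖coeField W - 1‖ ≤ ρ'' → SmallBelow (Node00.avOfRecord F 2 Kt) k W)
    (hερ : 6 * ((((F.P Kt).d - 1 : ℕ)) : ℝ) * (F.P Kt).L * ν.εreg ≤ ρ'')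
    {εH B : ℝ}
    (hHB : ∀ (Wd : MSField (F.P Kt) SU2) (U₀ : GaugeField (F.P Kt) 0 SU2),
      AgreeOn (Bj ν.M₁ Z k) (avgFamily (avOfRecord F 2 Kt) U₀) Wd →
      (∀ i' : Fin (constrCard (Bj ν.M₁ Z k) k), ∃ U' : GaugeField (F.P Kt) 0 SU2,
        (∀ b ∈ feeds (((constrEnum (Bj ν.M₁ Z k) k).symm i').1 : ℕ) ((constrEnum (Bj ν.M₁ Z k) k).symm i').2.1, U' b = U₀ b) ∧
          SmallBelow (avOfRecord F 2 Kt) k U') →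
      (∀ (j : ℕ), 1 ≤ j → j ≤ k → ∀ y : Site (F.P Kt) j, embIter j y ∈ maxDomT ν.M₁ Z j → ∃ U' : GaugeField (F.P Kt) 0 SU2,
        (∀ c : PBond (F.P Kt) j, (c.src = y ∨ c.tgt = y) → ∀ b₀ : PBond (F.P Kt) 0,
          (iterBlockOf j b₀.src = c.src ∨ iterBlockOf j b₀.src = c.tgt) → (iterBlockOf j b₀.tgt = c.src ∨ iterBlockOf j b₀.tgt = c.tgt) → U' b₀ = U₀ b₀) ∧
        SmallBelow (avOfRecord F 2 Kt) k U') →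
      (∀ (j : ℕ), 1 ≤ j → j ≤ k → ∀ y : Site (F.P Kt) j, embIter j y ∈ maxDomT ν.M₁ Z j →
        PlaqSmallOn (boxPlaqs (fun κ => lift (F.P Kt) (embIter j y) κ - ((((F.P Kt).L ^ j : ℕ) : ℤ) + ((((F.P Kt).L ^ j - 1) / 2 : ℕ) : ℤ)))
          (fun κ => lift (F.P Kt) (embIter j y) κ + ((((F.P Kt).L ^ j : ℕ) : ℤ) + ((((F.P Kt).L ^ j - 1) / 2 : ℕ) : ℤ))) : Set (Plaq (F.P Kt) 0)) εH U₀) →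
      ∃ H : (Fin (constrCard (Bj ν.M₁ Z k) k) → lieSU (Fin 2)) → PBond (F.P Kt) 0 → lieSU (Fin 2),
        (∀ v, fderiv ℝ (msChart F 2 Kt k (Bj ν.M₁ Z k) Wd U₀) 0 (H v) = v) ∧ ∀ v, Real.sqrt (∑ b, ‖H v b‖ ^ 2) ≤ B * ‖v‖)
    (hεH : ν.εreg ≤ εH)
    (ext : GaugeField (F.P Kt) k SU2 → GaugeField (F.P Kt) k SU2) (hext : ∀ W, ext W = extend (pts k Λ) (shellGauge W lo hi) W)
    {𝓐₀ : ℝ} (h𝓐₀ : 1 < 𝓐₀) (eR : ℝ) (heR : 0 < eR)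
    -- the knit's own GEOMETRY rows of the instance (window box `[lo, hi]` = `Λ^{(k)}`, its collar inside `Z`, no wrap) and the extension constant `cE ≥ 12d(n+2)²` (12Q v11's `hcE`),
    -- from which the datum's scale-`k` regularity on `Z` at `δ := 2(cE+1)·eR` follows (`dist1_plaqHol_extend_shellGauge_le`); the tower-box budget at that `δ` against the height's `ρ″`
    (n : ℕ) (hn : ∀ κ, hi κ ≤ lo κ + n) (hN3 : ∀ κ, hi κ - lo κ + 3 < ((F.P Kt).sitesPerDir k : ℤ)) (hlohi : lo ≤ hi)
    (hbox : pts k Λ = (castSite '' Set.Icc lo hi : Set (Site (F.P Kt) k)))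
    (hZ : (boxPlaqs (lo - 1) (hi + 1) : Set (Plaq (F.P Kt) k)) ⊆ plaqsInside (pts k Z))
    {cE : ℝ} (hcE : 12 * ((F.P Kt).d : ℝ) * ((n : ℝ) + 2) ^ 2 ≤ cE) (hδρ : 6 * ((((F.P Kt).d - 1 : ℕ)) : ℝ) * (F.P Kt).L ^ k * (2 * ((cE + 1) * eR)) ≤ ρ'')
    (hletters : ∀ Vk : GaugeField (F.P Kt) k SU2, (∀ p ∈ plaqsInside (pts k (Z ∩ Λᶜ)), dist1 (GaugeField.plaqHol Vk p) ≤ eR) → ∃ U₀ : GaugeField (F.P Kt) 0 SU2,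
      IsMinimizer (Node00.avOfRecord F 2 Kt) (Node00.regMSCoPOfRecord F 2 ν Kt k (maxDomT ν.M₁ Z)) (Bj ν.M₁ Z k)
        (avgFamily (Node00.avOfRecord F 2 Kt) (qsstarGIter0 k (ext Vk))) U₀ ∧
      -- (NO datum-regularity row: discharged below from the closed guard on `Z ∩ Λᶜ` and the p. 193 extension)
      -- DISPLAYED (β) ON EVERY FOREST AXIAL SLICE through the constrained towers of `𝐁_k(Z)` — REAL currency, kernel premise in `DΦ₀(0)` currency (the lane's twin; NOT `dIterL`)
      (∀ (S : Submodule ℂ (VecField (F.P Kt) 0 (EuclideanSpace ℂ (Fin 3)))) (path : Site (F.P Kt) 0 → List (LStep (F.P Kt) 0)),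
        (∀ x, ∀ s ∈ path x, ∃ x' x'' : Site (F.P Kt) 0, path x'' = path x' ++ [s] ∧
          (s.fwd = true → s.bond.src = x' ∧ s.bond.tgt = x'') ∧ (s.fwd = false → s.bond.src = x'' ∧ s.bond.tgt = x')) →
        (∀ j, j ≤ k → ∀ c ∈ bondsOf (Bj ν.M₁ Z k j), path (embIter j c.src) = [] ∧ path (embIter j c.tgt) = []) →
        (∀ X : VecField (F.P Kt) 0 (EuclideanSpace ℂ (Fin 3)), X ∈ S ↔ ∀ x, ∀ s ∈ path x, X s.bond = 0) →
        ∀ ℓ₀ : (Fin (constrCard (Bj ν.M₁ Z k) k) → EuclideanSpace ℂ (Fin 3)) →L[ℂ] ℂ,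
          fderiv ℂ (fun X : S => ∑ p : Plaq (F.P Kt) 0, (1 - (expMulC (X : VecField (F.P Kt) 0 (EuclideanSpace ℂ (Fin 3))) (coeField U₀) ⟨p.src, p.μ⟩ *
            expMulC (X : VecField (F.P Kt) 0 (EuclideanSpace ℂ (Fin 3))) (coeField U₀) ⟨p.src.shift p.μ, p.ν⟩ *
            Matrix.adjugate (expMulC (X : VecField (F.P Kt) 0 (EuclideanSpace ℂ (Fin 3))) (coeField U₀) ⟨p.src.shift p.ν, p.μ⟩) *
            Matrix.adjugate (expMulC (X : VecField (F.P Kt) 0 (EuclideanSpace ℂ (Fin 3))) (coeField U₀) ⟨p.src, p.ν⟩)).trace / 2)) 0 =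
            ℓ₀.comp (fderiv ℂ (fun (X : S) (i : Fin (constrCard (Bj ν.M₁ Z k) k)) =>
              logCoordC (star ((avgFamily (Node00.avOfRecord F 2 Kt) (qsstarGIter0 k (ext Vk))
                ((constrEnum (Bj ν.M₁ Z k) k).symm i).1 ((constrEnum (Bj ν.M₁ Z k) k).symm i).2.1 : SU2) : Matrix (Fin 2) (Fin 2) ℂ) *
                iterMh ((constrEnum (Bj ν.M₁ Z k) k).symm i).1 (expMulC (X : VecField (F.P Kt) 0 (EuclideanSpace ℂ (Fin 3))) (coeField U₀))
                  ((constrEnum (Bj ν.M₁ Z k) k).symm i).2.1)) 0) →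
          ∀ (p : VecField (F.P Kt) 0 E3) (hp : cplxVec p ∈ S), p ≠ 0 →
            fderiv ℂ (fun (X : S) (i : Fin (constrCard (Bj ν.M₁ Z k) k)) =>
              logCoordC (star ((avgFamily (Node00.avOfRecord F 2 Kt) (qsstarGIter0 k (ext Vk))
                ((constrEnum (Bj ν.M₁ Z k) k).symm i).1 ((constrEnum (Bj ν.M₁ Z k) k).symm i).2.1 : SU2) : Matrix (Fin 2) (Fin 2) ℂ) *
                iterMh ((constrEnum (Bj ν.M₁ Z k) k).symm i).1 (expMulC (X : VecField (F.P Kt) 0 (EuclideanSpace ℂ (Fin 3))) (coeField U₀))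
                  ((constrEnum (Bj ν.M₁ Z k) k).symm i).2.1)) 0 ⟨cplxVec p, hp⟩ = 0 →
            0 < deriv (deriv (fun t : ℝ => wilsonAction4 (expMul su2Chart (t • p) U₀) -
              (ℓ₀ ((fun (X : S) (i : Fin (constrCard (Bj ν.M₁ Z k) k)) =>
                logCoordC (star ((avgFamily (Node00.avOfRecord F 2 Kt) (qsstarGIter0 k (ext Vk))
                  ((constrEnum (Bj ν.M₁ Z k) k).symm i).1 ((constrEnum (Bj ν.M₁ Z k) k).symm i).2.1 : SU2) : Matrix (Fin 2) (Fin 2) ℂ) *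
                  iterMh ((constrEnum (Bj ν.M₁ Z k) k).symm i).1 (expMulC (X : VecField (F.P Kt) 0 (EuclideanSpace ℂ (Fin 3))) (coeField U₀))
                    ((constrEnum (Bj ν.M₁ Z k) k).symm i).2.1)) ((t : ℂ) • ⟨cplxVec p, hp⟩))).re)) 0) ∧
      -- DISPLAYED (T1@q₀) over the CLOSURE of NODE 00's class: the tower-central orbit of `U₀` is the unique minimal orbit
      (∀ U ∈ closure (Node00.regMSCoPOfRecord F 2 ν Kt k (maxDomT ν.M₁ Z)),
        AgreeOn (Bj ν.M₁ Z k) (avgFamily (Node00.avOfRecord F 2 Kt) U) (avgFamily (Node00.avOfRecord F 2 Kt) (qsstarGIter0 k (ext Vk))) →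
        wilsonAction4 U ≤ wilsonAction4 U₀ →
          ∃ u : GaugeTransf (F.P Kt) 0 SU2, (∀ j, j ≤ k → ∀ b ∈ bondsOf (Bj ν.M₁ Z k j),
            toMS u j b.src = toMS u j b.tgt ∧ ∀ g : SU2, toMS u j b.src * g = g * toMS u j b.src) ∧ gaugeAct u U = U₀)) :
    ∃ R : ℝ, 0 < R ∧ ∀ Vk : GaugeField (F.P Kt) k SU2, PlaqSmallOn (plaqsInside (pts k (Z ∩ Λᶜ))) eR Vk →
      ∃ Ũ : VecField (F.P Kt) k (EuclideanSpace ℂ (Fin 3)) × VecField (F.P Kt) k (EuclideanSpace ℂ (Fin 3)) → PBond (F.P Kt) 0 → Matrix (Fin 2) (Fin 2) ℂ,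
        (∀ b i j, DifferentiableOn ℂ (fun z => Ũ z b i j) (ball 0 R)) ∧
        (∀ z ∈ ball (0 : VecField (F.P Kt) k (EuclideanSpace ℂ (Fin 3)) × VecField (F.P Kt) k (EuclideanSpace ℂ (Fin 3))) R, ∀ b i j, ‖Ũ z b i j‖ ≤ 𝓐₀) ∧
        ∀ p B' : VecField (F.P Kt) k E3, ‖p‖ < R → ‖B'‖ < R → ∃ U' : GaugeField (F.P Kt) 0 SU2,
          (∀ b, Ũ (cplxVec p, cplxVec B') b = ((U' b : SU2) : Matrix (Fin 2) (Fin 2) ℂ)) ∧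
            IsMinimizer (Node00.avOfRecord F 2 Kt) (Node00.regMSCoPOfRecord F 2 ν Kt k (maxDomT ν.M₁ Z)) (Bj ν.M₁ Z k)
              (avgFamily (Node00.avOfRecord F 2 Kt) (qsstarGIter0 k (expMul su2Chart B' (ext (expMul su2Chart p Vk))))) U' := by
  have hcE0 : 0 ≤ cE := le_trans (by positivity) hcE
  have hδ : 0 < 2 * ((cE + 1) * eR) := by positivity
  obtain ⟨R, hR, h⟩ := hMin_closedGuard_atRecord_Bj_of_printLetters_ofClassTower ν Kt hd3 Z (pts k Λ) lo hi hkK hk1 hdiv hfloor hZblk hε hα3 hα2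
    hsbU hερ hδ hδρ hHB hεH ext hext h𝓐₀ (plaqsInside (pts k (Z ∩ Λᶜ))) eR fun Vk hVk => by
      obtain ⟨U₀, hmin, hβ, hT1⟩ := hletters Vk hVk
      refine ⟨U₀, hmin, fun p hp => ?_, hβ, hT1⟩
      -- the closed guard `≤ eR` gives the strict guard `< 2eR`; the p. 193 extension is then `12d(n+2)²·2eR`-regular on `Z^{(k)}`
      have h2 : PlaqSmallOn (plaqsInside (pts k (Z ∩ Λᶜ))) (2 * eR) Vk := fun q hq => (hVk q hq).trans_lt (by linarith)
      have hreg := (dist1_plaqHol_extend_shellGauge_le (G := SU2) hd3 hlohi hn hN3 hbox hZ (by positivity) h2).1 p hp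
      rw [hext]
      refine hreg.trans_lt ?_
      have h1 : 12 * ((F.P Kt).d : ℝ) * ((n : ℝ) + 2) ^ 2 * (2 * eR) ≤ cE * (2 * eR) := mul_le_mul_of_nonneg_right hcE (by positivity)
      have h3 : cE * (2 * eR) + 2 * eR = 2 * ((cE + 1) * eR) := by ring
      linarith
  exact ⟨R, hR, fun Vk hVk => h Vk (plaqLeOn_of_plaqSmallOn hVk)⟩


/-! ## §2 (v1.1)  The same from the `_nearFlat` sibling `N12MinimiserFamilyAtRecordBjTowerNearFlat` (this seat, over the lane's NEAR-FLAT capstone (O′)): the (β) row SPLIT into (δ) + (P) + (M)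
along print's road (1.9) ⟸ (1.7) + (1.8); per base field EXACTLY (E) + (δ) + (P) + (M) + (T1@q₀), the datum's regularity row discharged as in §1 -/

/-- ★★★ **THE KNIT's (J0′) ROW SHAPE, UNDER `∃ R > 0`, FROM (E) + (δ) + (P) + (M) + (T1@q₀) PER BASE FIELD** — over
`N12MinimiserFamilyAtRecordBjTowerNearFlat.hMin_closedGuard_atRecord_Bj_of_printLetters_ofClassTowerNearFlat` (w1 g4's chart theorem at `𝐁_k(Z)` over the lane's near-flat capstone
`N12MinimiserFamilyOfClassNearFlatCoercive`, dag-n12-c g25: (β) derived from (δ) near-flatness of `U₀` at the `Ω₁(Z)`-touching plaquettes, (P) flat coercivity on the `DΦ₀(0)`-kernel,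
(M) the multiplier letter — `B15Prop1RealCoerciveFromNearFlatExpansion`), with the datum's scale-`k` regularity row DISCHARGED at `δ := 2(cE+1)·eR` from the closed guard on
`(Z ∩ Λᶜ)^{(k)}` and the p. 193 extension (`dist1_plaqHol_extend_shellGauge_le`) through the knit's own geometry rows, exactly as §1.  Per base field of the closed guard the consumer
supplies: (E) the (2.12) minimiser `U₀`; (δ) (a GAUGE letter — the direct road's (N)-package clause shape); (P) and (M) on every forest axial slice (`a`, `Φ₀` inlined); (T1@q₀) over
the closure of the class.  Once per height: `ρ″` + floors (`6(d−1)L·εreg ≤ ρ″`, `6(d−1)Lᵏ·2(cE+1)eR ≤ ρ″`), `hHB` + `εreg ≤ εH`, `0 ≤ δc`, `64(d−1)δc + m < cP`; numerics.  Conclusion: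
12Q ∕ 12X-W v11's `hMin P i` ∀-body on the strict guard.
[cite: Balaban1989LargeFieldI, (1.74) p.192, p.193 L14–20, Prop. 1 p.194; Balaban1985Variational, Thm 1 p.279, (7) p.278, Sect. C (44)–(48) p.285, (79) p.290, (82)–(83) p.290, Prop. 9 (190) p.309; Balaban1989LargeFieldII, (1.7)–(1.9) p.358; Balaban1988Convergent, (2.2) p.255, (2.10)–(2.13) pp.256–257; Balaban1985Averaging, Prop. 2 (52)–(54) p.26; Balaban1987RG1, (0.4) p.253] -/
theorem exists_R_hMinRow_of_printLetters_ofClassTowerNearFlat (ν : Node00.Stage7Numerics) (Kt : ℕ) (hd3 : 3 ≤ (F.P Kt).d) (Z Λ : Set (Site (F.P Kt) 0))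
    (lo hi : Fin (F.P Kt).d → ℤ) (hkK : k + 1 ≤ (F.P Kt).m + (F.P Kt).K) (hk1 : 1 ≤ k)
    (hdiv : side (F.P Kt).L ν.M₁ k ∣ (F.P Kt).sitesPerDir 0) (hfloor : ((F.P Kt).d + 14) * (F.P Kt).L ≤ ν.M₁) (hZblk : IsBlockUnion k Z) (hε : 0 < ν.εreg)
    (hα3 : (143 * (((((F.P Kt).d + 4 : ℕ) : ℝ)) ^ 2 / 4) ^ 2) * (2 * ((F.P Kt).L : ℝ) ^ 2 * ν.εreg) ≤ 1 / 3)
    (hα2 : 2 * (2 * ((F.P Kt).L : ℝ) ^ 2 * ν.εreg) ≤ 2 * deltaSU (Fin 2) / ((((F.P Kt).d + 4) * (F.P Kt).L : ℕ) : ℝ) ^ 2)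
    -- the per-HEIGHT letters: `ρ″` with its two volume-free floors, dag-n12-w6's (P4)′ proxies letter `hHB` at `(εH, B)` with `εreg ≤ εH`, and the numerics of the (β) split:
    -- the near-flat tolerance `δc`, the flat coercivity constant `cP`, the multiplier constant `m`, with `64(d−1)·δc + m < cP`
    {ρ'' : ℝ} (hsbU : ∀ W : GaugeField (F.P Kt) 0 SU2, ‖coeField W - 1‖ ≤ ρ'' → SmallBelow (Node00.avOfRecord F 2 Kt) k W)
    (hερ : 6 * ((((F.P Kt).d - 1 : ℕ)) : ℝ) * (F.P Kt).L * ν.εreg ≤ ρ'')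
    {εH B : ℝ}
    (hHB : ∀ (Wd : MSField (F.P Kt) SU2) (U₀ : GaugeField (F.P Kt) 0 SU2),
      AgreeOn (Bj ν.M₁ Z k) (avgFamily (avOfRecord F 2 Kt) U₀) Wd →
      (∀ i' : Fin (constrCard (Bj ν.M₁ Z k) k), ∃ U' : GaugeField (F.P Kt) 0 SU2,
        (∀ b ∈ feeds (((constrEnum (Bj ν.M₁ Z k) k).symm i').1 : ℕ) ((constrEnum (Bj ν.M₁ Z k) k).symm i').2.1, U' b = U₀ b) ∧
          SmallBelow (avOfRecord F 2 Kt) k U') →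
      (∀ (j : ℕ), 1 ≤ j → j ≤ k → ∀ y : Site (F.P Kt) j, embIter j y ∈ maxDomT ν.M₁ Z j → ∃ U' : GaugeField (F.P Kt) 0 SU2,
        (∀ c : PBond (F.P Kt) j, (c.src = y ∨ c.tgt = y) → ∀ b₀ : PBond (F.P Kt) 0,
          (iterBlockOf j b₀.src = c.src ∨ iterBlockOf j b₀.src = c.tgt) → (iterBlockOf j b₀.tgt = c.src ∨ iterBlockOf j b₀.tgt = c.tgt) → U' b₀ = U₀ b₀) ∧
        SmallBelow (avOfRecord F 2 Kt) k U') →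
      (∀ (j : ℕ), 1 ≤ j → j ≤ k → ∀ y : Site (F.P Kt) j, embIter j y ∈ maxDomT ν.M₁ Z j →
        PlaqSmallOn (boxPlaqs (fun κ => lift (F.P Kt) (embIter j y) κ - ((((F.P Kt).L ^ j : ℕ) : ℤ) + ((((F.P Kt).L ^ j - 1) / 2 : ℕ) : ℤ)))
          (fun κ => lift (F.P Kt) (embIter j y) κ + ((((F.P Kt).L ^ j : ℕ) : ℤ) + ((((F.P Kt).L ^ j - 1) / 2 : ℕ) : ℤ))) : Set (Plaq (F.P Kt) 0)) εH U₀) →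
      ∃ H : (Fin (constrCard (Bj ν.M₁ Z k) k) → lieSU (Fin 2)) → PBond (F.P Kt) 0 → lieSU (Fin 2),
        (∀ v, fderiv ℝ (msChart F 2 Kt k (Bj ν.M₁ Z k) Wd U₀) 0 (H v) = v) ∧ ∀ v, Real.sqrt (∑ b, ‖H v b‖ ^ 2) ≤ B * ‖v‖)
    (hεH : ν.εreg ≤ εH)
    {δc cP m : ℝ} (hδc0 : 0 ≤ δc) (hnum : 64 * (((F.P Kt).d : ℝ) - 1) * δc + m < cP)
    (ext : GaugeField (F.P Kt) k SU2 → GaugeField (F.P Kt) k SU2) (hext : ∀ W, ext W = extend (pts k Λ) (shellGauge W lo hi) W)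
    {𝓐₀ : ℝ} (h𝓐₀ : 1 < 𝓐₀) (eR : ℝ) (heR : 0 < eR)
    -- the knit's own GEOMETRY rows of the instance and the extension constant `cE ≥ 12d(n+2)²` (12Q v11's `hcE`), from which the datum's scale-`k` regularity on `Z` at
    -- `δ := 2(cE+1)·eR` follows (`dist1_plaqHol_extend_shellGauge_le`); the tower-box budget at that `δ` against the height's `ρ″`
    (n : ℕ) (hn : ∀ κ, hi κ ≤ lo κ + n) (hN3 : ∀ κ, hi κ - lo κ + 3 < ((F.P Kt).sitesPerDir k : ℤ)) (hlohi : lo ≤ hi)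
    (hbox : pts k Λ = (castSite '' Set.Icc lo hi : Set (Site (F.P Kt) k)))
    (hZ : (boxPlaqs (lo - 1) (hi + 1) : Set (Plaq (F.P Kt) k)) ⊆ plaqsInside (pts k Z))
    {cE : ℝ} (hcE : 12 * ((F.P Kt).d : ℝ) * ((n : ℝ) + 2) ^ 2 ≤ cE) (hδρ : 6 * ((((F.P Kt).d - 1 : ℕ)) : ℝ) * (F.P Kt).L ^ k * (2 * ((cE + 1) * eR)) ≤ ρ'')
    (hletters : ∀ Vk : GaugeField (F.P Kt) k SU2, (∀ p ∈ plaqsInside (pts k (Z ∩ Λᶜ)), dist1 (GaugeField.plaqHol Vk p) ≤ eR) → ∃ U₀ : GaugeField (F.P Kt) 0 SU2,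
      IsMinimizer (Node00.avOfRecord F 2 Kt) (Node00.regMSCoPOfRecord F 2 ν Kt k (maxDomT ν.M₁ Z)) (Bj ν.M₁ Z k)
        (avgFamily (Node00.avOfRecord F 2 Kt) (qsstarGIter0 k (ext Vk))) U₀ ∧
      -- (NO datum-regularity row: discharged below from the closed guard on `Z ∩ Λᶜ` and the p. 193 extension)
      -- (δ) DISPLAYED (GAUGE letter, the direct road's (N)-package clause): `U₀` bondwise `δc`-flat on the plaquettes meeting a bond sourced in `Ω₁(Z)`
      (∀ q : Plaq (F.P Kt) 0, ((⟨q.src, q.μ⟩ : PBond (F.P Kt) 0) ∈ {b : PBond (F.P Kt) 0 | b.src ∈ maxDomT ν.M₁ Z 1} ∨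
          (⟨q.src.shift q.μ, q.ν⟩ : PBond (F.P Kt) 0) ∈ {b : PBond (F.P Kt) 0 | b.src ∈ maxDomT ν.M₁ Z 1} ∨
          (⟨q.src.shift q.ν, q.μ⟩ : PBond (F.P Kt) 0) ∈ {b : PBond (F.P Kt) 0 | b.src ∈ maxDomT ν.M₁ Z 1} ∨
          (⟨q.src, q.ν⟩ : PBond (F.P Kt) 0) ∈ {b : PBond (F.P Kt) 0 | b.src ∈ maxDomT ν.M₁ Z 1}) →
        ‖((U₀ ⟨q.src, q.μ⟩ : SU2) : Matrix (Fin 2) (Fin 2) ℂ) - 1‖ ≤ δc ∧ ‖((U₀ ⟨q.src.shift q.μ, q.ν⟩ : SU2) : Matrix (Fin 2) (Fin 2) ℂ) - 1‖ ≤ δc ∧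
          ‖((U₀ ⟨q.src.shift q.ν, q.μ⟩ : SU2) : Matrix (Fin 2) (Fin 2) ℂ) - 1‖ ≤ δc ∧ ‖((U₀ ⟨q.src, q.ν⟩ : SU2) : Matrix (Fin 2) (Fin 2) ℂ) - 1‖ ≤ δc) ∧
      -- (P) DISPLAYED ON EVERY FOREST AXIAL SLICE: FLAT COERCIVITY on the real kernel of `DΦ₀(0)` (`Φ₀` inlined) — [LF-II] (1.8) ∕ [10] (1.67) currency
      (∀ (S : Submodule ℂ (VecField (F.P Kt) 0 (EuclideanSpace ℂ (Fin 3)))) (path : Site (F.P Kt) 0 → List (LStep (F.P Kt) 0)),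
        (∀ x, ∀ s ∈ path x, ∃ x' x'' : Site (F.P Kt) 0, path x'' = path x' ++ [s] ∧
          (s.fwd = true → s.bond.src = x' ∧ s.bond.tgt = x'') ∧ (s.fwd = false → s.bond.src = x'' ∧ s.bond.tgt = x')) →
        (∀ j, j ≤ k → ∀ c ∈ bondsOf (Bj ν.M₁ Z k j), path (embIter j c.src) = [] ∧ path (embIter j c.tgt) = []) →
        (∀ X : VecField (F.P Kt) 0 (EuclideanSpace ℂ (Fin 3)), X ∈ S ↔ ∀ x, ∀ s ∈ path x, X s.bond = 0) →
        ∀ (p : VecField (F.P Kt) 0 E3) (hp : cplxVec p ∈ S), fderiv ℂ (fun (X : S) (i : Fin (constrCard (Bj ν.M₁ Z k) k)) =>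
                logCoordC (star ((avgFamily (Node00.avOfRecord F 2 Kt) (qsstarGIter0 k (ext Vk))
                  ((constrEnum (Bj ν.M₁ Z k) k).symm i).1 ((constrEnum (Bj ν.M₁ Z k) k).symm i).2.1 : SU2) : Matrix (Fin 2) (Fin 2) ℂ) *
                  iterMh ((constrEnum (Bj ν.M₁ Z k) k).symm i).1 (expMulC (X : VecField (F.P Kt) 0 (EuclideanSpace ℂ (Fin 3))) (coeField U₀))
                    ((constrEnum (Bj ν.M₁ Z k) k).symm i).2.1)) 0 ⟨cplxVec p, hp⟩ = 0 →
          cP * ∑ b : PBond (F.P Kt) 0, ‖p b‖ ^ 2 ≤ deriv (deriv fun s : ℝ => wilsonAction4 (expMul su2Chart (s • p) (1 : GaugeField (F.P Kt) 0 SU2))) 0) ∧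
      -- (M) DISPLAYED ON EVERY FOREST AXIAL SLICE: the MULTIPLIER letter (`a`, `Φ₀` inlined) — [15] (79) p.290 `Δ₁` currency, dag-n12-w6's (R1) road
      (∀ (S : Submodule ℂ (VecField (F.P Kt) 0 (EuclideanSpace ℂ (Fin 3)))) (path : Site (F.P Kt) 0 → List (LStep (F.P Kt) 0)),
        (∀ x, ∀ s ∈ path x, ∃ x' x'' : Site (F.P Kt) 0, path x'' = path x' ++ [s] ∧
          (s.fwd = true → s.bond.src = x' ∧ s.bond.tgt = x'') ∧ (s.fwd = false → s.bond.src = x'' ∧ s.bond.tgt = x')) →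
        (∀ j, j ≤ k → ∀ c ∈ bondsOf (Bj ν.M₁ Z k j), path (embIter j c.src) = [] ∧ path (embIter j c.tgt) = []) →
        (∀ X : VecField (F.P Kt) 0 (EuclideanSpace ℂ (Fin 3)), X ∈ S ↔ ∀ x, ∀ s ∈ path x, X s.bond = 0) →
        ∀ ℓ₀ : (Fin (constrCard (Bj ν.M₁ Z k) k) → EuclideanSpace ℂ (Fin 3)) →L[ℂ] ℂ, fderiv ℂ (fun X : S => ∑ p : Plaq (F.P Kt) 0, (1 - (expMulC (X : VecField (F.P Kt) 0 (EuclideanSpace ℂ (Fin 3))) (coeField U₀) ⟨p.src, p.μ⟩ *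
              expMulC (X : VecField (F.P Kt) 0 (EuclideanSpace ℂ (Fin 3))) (coeField U₀) ⟨p.src.shift p.μ, p.ν⟩ *
              Matrix.adjugate (expMulC (X : VecField (F.P Kt) 0 (EuclideanSpace ℂ (Fin 3))) (coeField U₀) ⟨p.src.shift p.ν, p.μ⟩) *
              Matrix.adjugate (expMulC (X : VecField (F.P Kt) 0 (EuclideanSpace ℂ (Fin 3))) (coeField U₀) ⟨p.src, p.ν⟩)).trace / 2)) 0 = ℓ₀.comp (fderiv ℂ (fun (X : S) (i : Fin (constrCard (Bj ν.M₁ Z k) k)) =>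
                logCoordC (star ((avgFamily (Node00.avOfRecord F 2 Kt) (qsstarGIter0 k (ext Vk))
                  ((constrEnum (Bj ν.M₁ Z k) k).symm i).1 ((constrEnum (Bj ν.M₁ Z k) k).symm i).2.1 : SU2) : Matrix (Fin 2) (Fin 2) ℂ) *
                  iterMh ((constrEnum (Bj ν.M₁ Z k) k).symm i).1 (expMulC (X : VecField (F.P Kt) 0 (EuclideanSpace ℂ (Fin 3))) (coeField U₀))
                    ((constrEnum (Bj ν.M₁ Z k) k).symm i).2.1)) 0) →
          ∀ (p : VecField (F.P Kt) 0 E3) (hp : cplxVec p ∈ S), fderiv ℂ (fun (X : S) (i : Fin (constrCard (Bj ν.M₁ Z k) k)) =>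
                logCoordC (star ((avgFamily (Node00.avOfRecord F 2 Kt) (qsstarGIter0 k (ext Vk))
                  ((constrEnum (Bj ν.M₁ Z k) k).symm i).1 ((constrEnum (Bj ν.M₁ Z k) k).symm i).2.1 : SU2) : Matrix (Fin 2) (Fin 2) ℂ) *
                  iterMh ((constrEnum (Bj ν.M₁ Z k) k).symm i).1 (expMulC (X : VecField (F.P Kt) 0 (EuclideanSpace ℂ (Fin 3))) (coeField U₀))
                    ((constrEnum (Bj ν.M₁ Z k) k).symm i).2.1)) 0 ⟨cplxVec p, hp⟩ = 0 →
            (ℓ₀ (fderiv ℂ (fderiv ℂ (fun (X : S) (i : Fin (constrCard (Bj ν.M₁ Z k) k)) =>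
                logCoordC (star ((avgFamily (Node00.avOfRecord F 2 Kt) (qsstarGIter0 k (ext Vk))
                  ((constrEnum (Bj ν.M₁ Z k) k).symm i).1 ((constrEnum (Bj ν.M₁ Z k) k).symm i).2.1 : SU2) : Matrix (Fin 2) (Fin 2) ℂ) *
                  iterMh ((constrEnum (Bj ν.M₁ Z k) k).symm i).1 (expMulC (X : VecField (F.P Kt) 0 (EuclideanSpace ℂ (Fin 3))) (coeField U₀))
                    ((constrEnum (Bj ν.M₁ Z k) k).symm i).2.1))) 0 ⟨cplxVec p, hp⟩ ⟨cplxVec p, hp⟩)).re ≤ m * ∑ b : PBond (F.P Kt) 0, ‖p b‖ ^ 2) ∧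
      -- DISPLAYED (T1@q₀) over the CLOSURE of NODE 00's class: the tower-central orbit of `U₀` is the unique minimal orbit
      (∀ U ∈ closure (Node00.regMSCoPOfRecord F 2 ν Kt k (maxDomT ν.M₁ Z)),
        AgreeOn (Bj ν.M₁ Z k) (avgFamily (Node00.avOfRecord F 2 Kt) U) (avgFamily (Node00.avOfRecord F 2 Kt) (qsstarGIter0 k (ext Vk))) →
        wilsonAction4 U ≤ wilsonAction4 U₀ →
          ∃ u : GaugeTransf (F.P Kt) 0 SU2, (∀ j, j ≤ k → ∀ b ∈ bondsOf (Bj ν.M₁ Z k j),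
            toMS u j b.src = toMS u j b.tgt ∧ ∀ g : SU2, toMS u j b.src * g = g * toMS u j b.src) ∧ gaugeAct u U = U₀)) :
    ∃ R : ℝ, 0 < R ∧ ∀ Vk : GaugeField (F.P Kt) k SU2, PlaqSmallOn (plaqsInside (pts k (Z ∩ Λᶜ))) eR Vk →
      ∃ Ũ : VecField (F.P Kt) k (EuclideanSpace ℂ (Fin 3)) × VecField (F.P Kt) k (EuclideanSpace ℂ (Fin 3)) → PBond (F.P Kt) 0 → Matrix (Fin 2) (Fin 2) ℂ,
        (∀ b i j, DifferentiableOn ℂ (fun z => Ũ z b i j) (ball 0 R)) ∧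
        (∀ z ∈ ball (0 : VecField (F.P Kt) k (EuclideanSpace ℂ (Fin 3)) × VecField (F.P Kt) k (EuclideanSpace ℂ (Fin 3))) R, ∀ b i j, ‖Ũ z b i j‖ ≤ 𝓐₀) ∧
        ∀ p B' : VecField (F.P Kt) k E3, ‖p‖ < R → ‖B'‖ < R → ∃ U' : GaugeField (F.P Kt) 0 SU2,
          (∀ b, Ũ (cplxVec p, cplxVec B') b = ((U' b : SU2) : Matrix (Fin 2) (Fin 2) ℂ)) ∧
            IsMinimizer (Node00.avOfRecord F 2 Kt) (Node00.regMSCoPOfRecord F 2 ν Kt k (maxDomT ν.M₁ Z)) (Bj ν.M₁ Z k)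
              (avgFamily (Node00.avOfRecord F 2 Kt) (qsstarGIter0 k (expMul su2Chart B' (ext (expMul su2Chart p Vk))))) U' := by
  have hcE0 : 0 ≤ cE := le_trans (by positivity) hcE
  have hδ : 0 < 2 * ((cE + 1) * eR) := by positivity
  obtain ⟨R, hR, h⟩ := hMin_closedGuard_atRecord_Bj_of_printLetters_ofClassTowerNearFlat ν Kt hd3 Z (pts k Λ) lo hi hkK hk1 hdiv hfloor hZblk hε hα3 hα2
    hsbU hερ hδ hδρ hHB hεH hδc0 hnum ext hext h𝓐₀ (plaqsInside (pts k (Z ∩ Λᶜ))) eR fun Vk hVk => by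
      obtain ⟨U₀, hmin, hrowNF, hrowP, hrowM, hT1⟩ := hletters Vk hVk
      refine ⟨U₀, hmin, fun p hp => ?_, hrowNF, hrowP, hrowM, hT1⟩
      -- the closed guard `≤ eR` gives the strict guard `< 2eR`; the p. 193 extension is then `12d(n+2)²·2eR`-regular on `Z^{(k)}`
      have h2 : PlaqSmallOn (plaqsInside (pts k (Z ∩ Λᶜ))) (2 * eR) Vk := fun q hq => (hVk q hq).trans_lt (by linarith)
      have hreg := (dist1_plaqHol_extend_shellGauge_le (G := SU2) hd3 hlohi hn hN3 hbox hZ (by positivity) h2).1 p hp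
      rw [hext]
      refine hreg.trans_lt ?_
      have h1 : 12 * ((F.P Kt).d : ℝ) * ((n : ℝ) + 2) ^ 2 * (2 * eR) ≤ cE * (2 * eR) := mul_le_mul_of_nonneg_right hcE (by positivity)
      have h3 : cE * (2 * eR) + 2 * eR = 2 * ((cE + 1) * eR) := by ring
      linarith
  exact ⟨R, hR, fun Vk hVk => h Vk (plaqLeOn_of_plaqSmallOn hVk)⟩
end Summit.QuantumFields.YangMills.BalabanUVNodes.N12MinimiserFamilyKnitRowTower

end
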